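import Summits.AtomisticToContinuum.HydrodynamicLimit.Theses.LambertianContactSwap
import Summits.AtomisticToContinuum.HydrodynamicLimit.Theorems.LambertianContactSwapContactAngleEquidistributionNearFieldTools
import Literature.Analysis.FluidPDE.HardSphereFlowMeasurable
import Literature.MathematicalPhysics.KineticTheory.HardSphereEulerProofs
import HarnessLib

/-!
# Stub `stub_nearField` of the line `Sketch` of the crux `ContactAngleEquidistribution`
# (stmt-AtomisticToContinuum-12097, route LambertianContactSwap): REDUCTION of the near-field balance

Support file (`--supports`). The registered stub `stub_nearField` (lead skeleton `Cruxes/ContactAngleEquidistribution/Lines/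
Sketch.lean`) is the `NearFieldBalance` of the card `Ideas/last-flight-cap-pullback.md` — the crux's irreducible kernel, rated
XL/open: under the local Gibbs law the NEAR-FIELD part (a third sphere within `2ε` of a collider in the pre-collisional
configuration; an `N`-independent share `≍ 33σ³` of all collisions) of the capped, `|g|²`-weighted, `κ_g`-centred contact-angle
collision sum has normalised expectation `→ 0`. It is NOT proved here. This file states it (`NearFieldBalance`, verbatim the
registered signature, `@[conjecture]`) and PROVES it from two cleanly separated open statements (`@[conjecture]`):

* `NearFieldAdmissibleCosineLaw` — every admissible environment-blind mark is centred, in near-field collision average, by the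
  cosine law CONDITIONED ON THE ADMISSIBLE NORMALS of the actual pre-collisional environment (`admissibleNormals`: directions `n`
  such that the pair re-placed at `x_mid ± (ε/2) n`, all other spheres kept, overlaps no third sphere and is still near-field).
  EXACT IN EQUILIBRIUM AT EVERY `N`, with no isotropy input: by the stationary special-flow / Campbell identity (CIP 1994
  App. 4.A; tree `HardSphereCampbellFormula`) the pre-collisional contact flux in the coordinates `(x_mid, ω, others, velocities)`
  is `1_D (g·ω)₋ dω d(rest)`, and on each `ω`-fibre `1_D · [near]` is the indicator of the admissible normals, so the fibre
  integral of `ψ(ω) − κ^{adm}_g ψ` vanishes identically. Out of equilibrium: the evolved `N`-body density is, on flux-weighted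
  average, uniform along the `O(ε)`-long normal fibres of near-field contact configurations — pre-collisional (Lanford-direction)
  chaos at the contact scale INCLUDING the blocking environment; expected size `O(σ³)·O(Kn) → 0`.
* `NearFieldBlockingIsotropy` — the admissible-conditioned cosine mean and the full cosine mean of the mark agree in near-field
  collision average given `(s, x_mid, v, v_*)`: the environment-resolved near-field collision intensity, reweighted by
  `1/κ_g(admissible set)`, covers every direction of the incoming hemisphere equally. In equilibrium this is the rotation
  invariance of the positional Gibbs weight of the environments compatible with a contact dumbbell at `x_mid` (exact in infinite
  volume, periodic-image corrections on `𝕋³`); out of equilibrium it is the isotropy, given the pair velocities, of the law of the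
  pre-collisional near-field cluster SHAPE, whose shear-induced defect is `∝` velocity gradient × collision time `= O(Kn)`
  (Lutsko 1996).

`stub_nearFieldReduction : NearFieldAdmissibleCosineLaw → NearFieldBlockingIsotropy → NearFieldBalance` (registered sub-goal) is the bookkeeping: the two
summands add up pointwise to the stub's, and both marked collision sums are integrable for every `N` — measurable over Alexander's
construction (from the tree's `Alexander.measurable_*`) and dominated by twice the `|g|³`-weighted collision count, whose local
Gibbs expectation is finite for each `N` (`stub_nearFieldFinite` of the tools file `…Theorems.LambertianContactSwapContactAngleEquidistribution
NearFieldTools`: rung 0 `collisionMomentBound_const` + domination). WIRING for the lead skeleton: two new stubs `h₁ : NearFieldAdmissibleCosineLaw`,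
`h₂ : NearFieldBlockingIsotropy`, and `theorem stub_nearField : <registered signature> := stub_nearFieldReduction h₁ h₂` (elaborates: checked).

References: J. F. Lutsko, Phys. Rev. Lett. 77 (1996) 2225; C. Cercignani, R. Illner, M. Pulvirenti, *The Mathematical Theory of
Dilute Gases* (1994) §2.2, App. 4.A; I. Gallagher, L. Saint-Raymond, B. Texier, *From Newton to Boltzmann* (2013) Ch. 4.
-/

noncomputable section

open MeasureTheory Filter Set Topology ProbabilityTheory
open scoped ENNReal BigOperators Classical

namespace Summit.AtomisticToContinuum.HydrodynamicLimit.Theorems.ContactAngleEquidistributionSketch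

open Literature.Analysis.FluidPDE Literature.MathematicalPhysics.KineticTheory
open Summit.AtomisticToContinuum.HydrodynamicLimit.Theses.LambertianContactSwap

/-! ## The three statements (the crux's own `let` dialect; `NearFieldBalance` is verbatim the registered stub) -/

/-- `NearFieldBalance` — VERBATIM the registered stub `stub_nearField` of line `Sketch` (crux ContactAngleEquidistribution,
stmt-AtomisticToContinuum-12097): under the local Gibbs law the NEAR-FIELD part of the capped, `κ_g`-centred, `|g|²`-weighted
contact-angle collision sum has normalised expectation tending to `0`. OPEN (the crux's kernel, card `last-flight-cap-pullback`);
reduced below (`stub_nearFieldReduction`) to `NearFieldAdmissibleCosineLaw ∧ NearFieldBlockingIsotropy`. [cite: Lutsko1996, PRL 77 p. 2225] -/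
@[conjecture] def NearFieldBalance : Prop :=
    let Cfg : ℕ → Type := fun N => Config (N + 1) (Fin 3) T3; let G := Torus.geometry (Fin 3); let ε : ℝ → ℕ → ℝ := hsDiameter
    let τ : ℝ → (N : ℕ) → Cfg N → ℝ≥0∞ := fun σ N z => Alexander.freeExitTime G (ε σ N) z
    let S : ℝ → (N : ℕ) → Cfg N → Cfg N := fun t _ z => freeFlight G t z
    let ldir : V3 → V3 → V3 := fun ω ξ => ‖‖ω‖⁻¹ • ω + ‖ξ‖⁻¹ • ξ‖⁻¹ • (‖ω‖⁻¹ • ω + ‖ξ‖⁻¹ • ξ)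
    let zpre : ℝ → (N : ℕ) → Cfg N → ℕ → Cfg N := fun σ N z m => let y := Alexander.stateAfter G (ε σ N) z m; S (τ σ N y).toReal N y
    let Kt : ℝ → (N : ℕ) → Cfg N → ℝ → ℕ := fun σ N z t => Alexander.collisionCount G (ε σ N) z t
    let hit : ℝ → (N : ℕ) → Cfg N → Fin (N + 1) → Fin (N + 1) → Prop := fun σ N y i j =>
      i < j ∧ y ∈ contactSet G (N + 1) (ε σ N) i j ∧ IsIncoming G y i j
    let tcol : ℝ → (N : ℕ) → Cfg N → ℕ → ℝ := fun σ N z m => (Alexander.collisionInstant G (ε σ N) z (m + 1)).toReal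
    let xmid : (N : ℕ) → Cfg N → Fin (N + 1) → Fin (N + 1) → T3 := fun _ y i j => G.translate (y j).1 ((2 : ℝ)⁻¹ • G.sepVec (y i).1 (y j).1)
    let near : ℝ → (N : ℕ) → Cfg N → Fin (N + 1) → Fin (N + 1) → Prop := fun σ N y i j =>
      ∃ k : Fin (N + 1), k ≠ i ∧ k ≠ j ∧ (‖G.sepVec (y k).1 (y i).1‖ ≤ 2 * ε σ N ∨ ‖G.sepVec (y k).1 (y j).1‖ ≤ 2 * ε σ N)
    ∀ (a₀ θ₀ : T3 → ℝ) (u₀ : T3 → V3), Continuous a₀ → Continuous θ₀ → Continuous u₀ → (∀ x, 0 < a₀ x) → (∀ x, 0 < θ₀ x) →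
      ∃ σ₀ : ℝ, 0 < σ₀ ∧ ∀ σ : ℝ, 0 < σ → σ < σ₀ → ∀ Φ : (N : ℕ) → HardSphereFlow G (ε σ N) (N + 1),
      let P := fun N => localGibbsLaw σ a₀ u₀ θ₀ N (Φ N)
      ∀ t : ℝ, 0 ≤ t → ∀ V : ℝ, 0 < V → ∀ ψ : ℕ → ℝ → T3 → V3 → V3 → V3 → ℝ,
        (∀ N, Measurable (fun p : ℝ × T3 × V3 × V3 × V3 => ψ N p.1 p.2.1 p.2.2.1 p.2.2.2.1 p.2.2.2.2)) →
        (∀ N s x v w n, |ψ N s x v w n| ≤ 1) →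
        (∀ N s x v w (n n' : V3), ‖n‖ = 1 → ‖n'‖ = 1 → |ψ N s x v w n - ψ N s x v w n'| ≤ ‖n - n'‖) →
        Tendsto (fun N : ℕ => ∫ z, ((N : ℝ) + 1) ^ (-(4 / 3 : ℝ)) *
          ∑ m ∈ Finset.range (Kt σ N z t), ∑ i : Fin (N + 1), ∑ j : Fin (N + 1),
            (let y := zpre σ N z m
             if hit σ N y i j then
               (if near σ N y i j then
                 (if V < ‖(y i).2 - (y j).2‖ then 0 else
                   ‖(y i).2 - (y j).2‖ ^ 2 *
                     (ψ N (tcol σ N z m) (xmid N y i j) (y i).2 (y j).2 ((ε σ N)⁻¹ • G.sepVec (y i).1 (y j).1) -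
                       ∫ ξ, ψ N (tcol σ N z m) (xmid N y i j) (y i).2 (y j).2 (ldir (-((y i).2 - (y j).2)) ξ) ∂(stdGaussian V3)))
                else 0)
             else 0) ∂(P N)) atTop (𝓝 0)

/-- `NearFieldAdmissibleCosineLaw` (OPEN; the dynamical half of the near-field balance): in near-field, speed-capped,
`|g|²`-weighted collision average under the local Gibbs law, every admissible environment-blind mark `ψ_N(s, x_mid, v, v_*, ω)` is
centred by the cosine law conditioned on the admissible normals of the actual pre-collisional environment
(`admissibleCosineMean (admissibleNormals …)`). Exact in equilibrium at every `N` by the special-flow (Campbell) identity: the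
contact flux is `1_D (g·ω)₋ dω d(rest)` and `1_D·[near]` is the indicator of the admissible normals on each `ω`-fibre; in general a
pre-collisional chaos statement at the contact scale including the blocking environment. [cite: CIP1994, App. 4.A pp. 107–111] -/
@[conjecture] def NearFieldAdmissibleCosineLaw : Prop :=
    let Cfg : ℕ → Type := fun N => Config (N + 1) (Fin 3) T3; let G := Torus.geometry (Fin 3); let ε : ℝ → ℕ → ℝ := hsDiameter
    let τ : ℝ → (N : ℕ) → Cfg N → ℝ≥0∞ := fun σ N z => Alexander.freeExitTime G (ε σ N) z
    let S : ℝ → (N : ℕ) → Cfg N → Cfg N := fun t _ z => freeFlight G t z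
    let zpre : ℝ → (N : ℕ) → Cfg N → ℕ → Cfg N := fun σ N z m => let y := Alexander.stateAfter G (ε σ N) z m; S (τ σ N y).toReal N y
    let Kt : ℝ → (N : ℕ) → Cfg N → ℝ → ℕ := fun σ N z t => Alexander.collisionCount G (ε σ N) z t
    let hit : ℝ → (N : ℕ) → Cfg N → Fin (N + 1) → Fin (N + 1) → Prop := fun σ N y i j =>
      i < j ∧ y ∈ contactSet G (N + 1) (ε σ N) i j ∧ IsIncoming G y i j
    let tcol : ℝ → (N : ℕ) → Cfg N → ℕ → ℝ := fun σ N z m => (Alexander.collisionInstant G (ε σ N) z (m + 1)).toReal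
    let xmid : (N : ℕ) → Cfg N → Fin (N + 1) → Fin (N + 1) → T3 := fun _ y i j => G.translate (y j).1 ((2 : ℝ)⁻¹ • G.sepVec (y i).1 (y j).1)
    let near : ℝ → (N : ℕ) → Cfg N → Fin (N + 1) → Fin (N + 1) → Prop := fun σ N y i j =>
      ∃ k : Fin (N + 1), k ≠ i ∧ k ≠ j ∧ (‖G.sepVec (y k).1 (y i).1‖ ≤ 2 * ε σ N ∨ ‖G.sepVec (y k).1 (y j).1‖ ≤ 2 * ε σ N)
    let adm : ℝ → (N : ℕ) → Cfg N → Fin (N + 1) → Fin (N + 1) → Set V3 := fun σ N y i j => admissibleNormals (ε σ N) y i j (xmid N y i j)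
    ∀ (a₀ θ₀ : T3 → ℝ) (u₀ : T3 → V3), Continuous a₀ → Continuous θ₀ → Continuous u₀ → (∀ x, 0 < a₀ x) → (∀ x, 0 < θ₀ x) →
      ∃ σ₀ : ℝ, 0 < σ₀ ∧ ∀ σ : ℝ, 0 < σ → σ < σ₀ → ∀ Φ : (N : ℕ) → HardSphereFlow G (ε σ N) (N + 1),
      let P := fun N => localGibbsLaw σ a₀ u₀ θ₀ N (Φ N)
      ∀ t : ℝ, 0 ≤ t → ∀ V : ℝ, 0 < V → ∀ ψ : ℕ → ℝ → T3 → V3 → V3 → V3 → ℝ,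
        (∀ N, Measurable (fun p : ℝ × T3 × V3 × V3 × V3 => ψ N p.1 p.2.1 p.2.2.1 p.2.2.2.1 p.2.2.2.2)) →
        (∀ N s x v w n, |ψ N s x v w n| ≤ 1) →
        (∀ N s x v w (n n' : V3), ‖n‖ = 1 → ‖n'‖ = 1 → |ψ N s x v w n - ψ N s x v w n'| ≤ ‖n - n'‖) →
        Tendsto (fun N : ℕ => ∫ z, ((N : ℝ) + 1) ^ (-(4 / 3 : ℝ)) *
          ∑ m ∈ Finset.range (Kt σ N z t), ∑ i : Fin (N + 1), ∑ j : Fin (N + 1),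
            (let y := zpre σ N z m
             if hit σ N y i j then
               (if near σ N y i j then
                 (if V < ‖(y i).2 - (y j).2‖ then 0 else
                   ‖(y i).2 - (y j).2‖ ^ 2 *
                     (ψ N (tcol σ N z m) (xmid N y i j) (y i).2 (y j).2 ((ε σ N)⁻¹ • G.sepVec (y i).1 (y j).1) -
                       admissibleCosineMean (adm σ N y i j) ((y i).2 - (y j).2) (ψ N (tcol σ N z m) (xmid N y i j) (y i).2 (y j).2)))
                else 0)
             else 0) ∂(P N)) atTop (𝓝 0)

/-- `NearFieldBlockingIsotropy` (OPEN; the structural half of the near-field balance): in near-field, speed-capped, `|g|²`-weighted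
collision average under the local Gibbs law, the admissible-conditioned cosine mean of every admissible environment-blind mark agrees
with its full cosine mean `κ_g ψ` — the law of the admissible set of normals of near-field collisions given `(s, x_mid, v, v_*)`,
reweighted by `1/κ_g(admissible set)`, is isotropic on the incoming hemisphere. In equilibrium: rotation invariance of the positional
Gibbs weight of environments compatible with a contact dumbbell (exact in infinite volume); in general: isotropy, given the pair
velocities, of the pre-collisional near-field cluster shape, whose shear-induced defect is `∝ Kn`. [cite: Lutsko1996, PRL 77 p. 2225] -/
@[conjecture] def NearFieldBlockingIsotropy : Prop :=
    let Cfg : ℕ → Type := fun N => Config (N + 1) (Fin 3) T3; let G := Torus.geometry (Fin 3); let ε : ℝ → ℕ → ℝ := hsDiameter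
    let τ : ℝ → (N : ℕ) → Cfg N → ℝ≥0∞ := fun σ N z => Alexander.freeExitTime G (ε σ N) z
    let S : ℝ → (N : ℕ) → Cfg N → Cfg N := fun t _ z => freeFlight G t z
    let ldir : V3 → V3 → V3 := fun ω ξ => ‖‖ω‖⁻¹ • ω + ‖ξ‖⁻¹ • ξ‖⁻¹ • (‖ω‖⁻¹ • ω + ‖ξ‖⁻¹ • ξ)
    let zpre : ℝ → (N : ℕ) → Cfg N → ℕ → Cfg N := fun σ N z m => let y := Alexander.stateAfter G (ε σ N) z m; S (τ σ N y).toReal N y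
    let Kt : ℝ → (N : ℕ) → Cfg N → ℝ → ℕ := fun σ N z t => Alexander.collisionCount G (ε σ N) z t
    let hit : ℝ → (N : ℕ) → Cfg N → Fin (N + 1) → Fin (N + 1) → Prop := fun σ N y i j =>
      i < j ∧ y ∈ contactSet G (N + 1) (ε σ N) i j ∧ IsIncoming G y i j
    let tcol : ℝ → (N : ℕ) → Cfg N → ℕ → ℝ := fun σ N z m => (Alexander.collisionInstant G (ε σ N) z (m + 1)).toReal
    let xmid : (N : ℕ) → Cfg N → Fin (N + 1) → Fin (N + 1) → T3 := fun _ y i j => G.translate (y j).1 ((2 : ℝ)⁻¹ • G.sepVec (y i).1 (y j).1)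
    let near : ℝ → (N : ℕ) → Cfg N → Fin (N + 1) → Fin (N + 1) → Prop := fun σ N y i j =>
      ∃ k : Fin (N + 1), k ≠ i ∧ k ≠ j ∧ (‖G.sepVec (y k).1 (y i).1‖ ≤ 2 * ε σ N ∨ ‖G.sepVec (y k).1 (y j).1‖ ≤ 2 * ε σ N)
    let adm : ℝ → (N : ℕ) → Cfg N → Fin (N + 1) → Fin (N + 1) → Set V3 := fun σ N y i j => admissibleNormals (ε σ N) y i j (xmid N y i j)
    ∀ (a₀ θ₀ : T3 → ℝ) (u₀ : T3 → V3), Continuous a₀ → Continuous θ₀ → Continuous u₀ → (∀ x, 0 < a₀ x) → (∀ x, 0 < θ₀ x) →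
      ∃ σ₀ : ℝ, 0 < σ₀ ∧ ∀ σ : ℝ, 0 < σ → σ < σ₀ → ∀ Φ : (N : ℕ) → HardSphereFlow G (ε σ N) (N + 1),
      let P := fun N => localGibbsLaw σ a₀ u₀ θ₀ N (Φ N)
      ∀ t : ℝ, 0 ≤ t → ∀ V : ℝ, 0 < V → ∀ ψ : ℕ → ℝ → T3 → V3 → V3 → V3 → ℝ,
        (∀ N, Measurable (fun p : ℝ × T3 × V3 × V3 × V3 => ψ N p.1 p.2.1 p.2.2.1 p.2.2.2.1 p.2.2.2.2)) →
        (∀ N s x v w n, |ψ N s x v w n| ≤ 1) →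
        (∀ N s x v w (n n' : V3), ‖n‖ = 1 → ‖n'‖ = 1 → |ψ N s x v w n - ψ N s x v w n'| ≤ ‖n - n'‖) →
        Tendsto (fun N : ℕ => ∫ z, ((N : ℝ) + 1) ^ (-(4 / 3 : ℝ)) *
          ∑ m ∈ Finset.range (Kt σ N z t), ∑ i : Fin (N + 1), ∑ j : Fin (N + 1),
            (let y := zpre σ N z m
             if hit σ N y i j then
               (if near σ N y i j then
                 (if V < ‖(y i).2 - (y j).2‖ then 0 else
                   ‖(y i).2 - (y j).2‖ ^ 2 *
                     (admissibleCosineMean (adm σ N y i j) ((y i).2 - (y j).2) (ψ N (tcol σ N z m) (xmid N y i j) (y i).2 (y j).2) -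
                       ∫ ξ, ψ N (tcol σ N z m) (xmid N y i j) (y i).2 (y j).2 (ldir (-((y i).2 - (y j).2)) ξ) ∂(stdGaussian V3)))
                else 0)
             else 0) ∂(P N)) atTop (𝓝 0)

/-! ## The reduction -/

/-- **The near-field balance follows from the admissible-cosine law and blocking isotropy.** The two centred summands add up
pointwise to the stub's (`(ψ − κ^{adm}ψ) + (κ^{adm}ψ − κψ) = ψ − κψ`), and each marked collision sum is integrable under the local
Gibbs law for every `N` (measurable over Alexander's construction; dominated by twice the `|g|³`-weighted collision count, whose
expectation is finite for each `N`), so the expectations add and the two limits sum. -/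
theorem stub_nearFieldReduction : NearFieldAdmissibleCosineLaw → NearFieldBlockingIsotropy → NearFieldBalance := by
  intro H₁ H₂
  unfold NearFieldAdmissibleCosineLaw at H₁
  unfold NearFieldBlockingIsotropy at H₂
  unfold NearFieldBalance
  dsimp (config := { zeta := true }) only
  dsimp (config := { zeta := true }) only at H₁
  dsimp (config := { zeta := true }) only at H₂
  intro a₀ θ₀ u₀ ha hθ hu ha0 hθ0
  obtain ⟨σ₁, hσ₁, H₁⟩ := H₁ a₀ θ₀ u₀ ha hθ hu ha0 hθ0
  obtain ⟨σ₂, hσ₂, H₂⟩ := H₂ a₀ θ₀ u₀ ha hθ hu ha0 hθ0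
  have H₃ := stub_nearFieldFinite
  dsimp (config := { zeta := true }) only at H₃
  obtain ⟨σ₃, hσ₃, H₃⟩ := H₃ a₀ θ₀ u₀ ha hθ hu ha0 hθ0
  refine ⟨min (min σ₁ σ₂) (min σ₃ 2⁻¹), lt_min (lt_min hσ₁ hσ₂) (lt_min hσ₃ (by norm_num)), fun σ hσ hσlt Φ t ht V hV ψ hψm hψb hψl => ?_⟩
  have hσ12 : σ < min σ₁ σ₂ := hσlt.trans_le (min_le_left _ _)
  have hσ2 : σ < 2⁻¹ := (hσlt.trans_le (min_le_right _ _)).trans_le (min_le_right _ _)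
  have T₁ := H₁ σ hσ (hσ12.trans_le (min_le_left _ _)) Φ t ht V hV ψ hψm hψb hψl
  have T₂ := H₂ σ hσ (hσ12.trans_le (min_le_right _ _)) Φ t ht V hV ψ hψm hψb hψl
  have hW := H₃ σ hσ ((hσlt.trans_le (min_le_right _ _)).trans_le (min_le_left _ _)) Φ t ht
  have hK := fun N => NearField.measurable_Kt hσ hσ2 N t
  have hpre := fun N m => NearField.measurable_zpre hσ hσ2 N m
  have htc := fun N m => NearField.measurable_tcol hσ hσ2 N m
  have hκ : ∀ N s x v w (g : V3), |∫ ξ, ψ N s x v w (‖‖-g‖⁻¹ • (-g) + ‖ξ‖⁻¹ • ξ‖⁻¹ • (‖-g‖⁻¹ • (-g) + ‖ξ‖⁻¹ • ξ)) ∂(stdGaussian V3)| ≤ 1 :=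
    fun N s x v w g => NearField.abs_integral_le_one _ fun ξ => hψb N s x v w _
  -- measurability of the weight `(N+1)^{-4/3} Σ [hit] (1 + |g|³)` (its statement is read off `hW N` at each use)
  have hWm : ∀ N m (i j : Fin (N + 1)), Measurable fun z : Config (N + 1) (Fin 3) T3 =>
      1 + ‖((freeFlight (Torus.geometry (Fin 3)) (Alexander.freeExitTime (Torus.geometry (Fin 3)) (hsDiameter σ N)
        (Alexander.stateAfter (Torus.geometry (Fin 3)) (hsDiameter σ N) z m)).toReal (Alexander.stateAfter (Torus.geometry (Fin 3)) (hsDiameter σ N) z m)) i).2 -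
        ((freeFlight (Torus.geometry (Fin 3)) (Alexander.freeExitTime (Torus.geometry (Fin 3)) (hsDiameter σ N)
        (Alexander.stateAfter (Torus.geometry (Fin 3)) (hsDiameter σ N) z m)).toReal (Alexander.stateAfter (Torus.geometry (Fin 3)) (hsDiameter σ N) z m)) j).2‖ ^ 3 :=
    fun N m i j => measurable_const.fun_add (((NearField.measurable_vel' (hpre N m) i).fun_sub (NearField.measurable_vel' (hpre N m) j)).norm.pow_const 3)
  refine NearField.tendsto_integral_of_eq_add _ T₁ T₂ ?_ ?_ ?_
  · intro N
    refine NearField.integrable_of_abs_le (hW N) ?_ ?_ fun z => ?_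
    · refine (NearField.measurable_sum_range (hK N) fun m => Finset.measurable_sum _ fun i _ => Finset.measurable_sum _ fun j _ => ?_).const_mul _
      refine Measurable.ite (NearField.measurableSet_hit _ (hpre N m) i j) ?_ measurable_const
      refine Measurable.ite (NearField.measurableSet_near _ (hpre N m) i j) ?_ measurable_const
      have hg := (NearField.measurable_vel' (hpre N m) i).fun_sub (NearField.measurable_vel' (hpre N m) j)
      have hxm := NearField.measurable_xmid' (hpre N m) i j
      refine Measurable.ite (measurableSet_lt measurable_const hg.norm) measurable_const ((hg.norm.pow_const 2).fun_mul ?_)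
      exact (NearField.measurable_psiAt (hψm N) (htc N m) hxm (NearField.measurable_vel' (hpre N m) i) (NearField.measurable_vel' (hpre N m) j)
        ((measurable_const (a := (hsDiameter σ N)⁻¹)).fun_smul (NearField.measurable_sepVec' (hpre N m) i j))).fun_sub
        (NearField.measurable_admissibleCosineMean (hsDiameter σ N) (hpre N m) i j hxm hg
          (NearField.measurable_psiAt (hψm N) ((htc N m).comp measurable_fst) (hxm.comp measurable_fst)
            ((NearField.measurable_vel' (hpre N m) i).comp measurable_fst) ((NearField.measurable_vel' (hpre N m) j).comp measurable_fst) measurable_snd))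
    · refine (NearField.measurable_sum_range (hK N) fun m => Finset.measurable_sum _ fun i _ => Finset.measurable_sum _ fun j _ => ?_).const_mul _
      exact Measurable.ite (NearField.measurableSet_hit _ (hpre N m) i j) (hWm N m i j) measurable_const
    · refine NearField.abs_mul_sum3_le_two_mul _ _ (by positivity) _ _ fun m i j => ?_
      split_ifs
      · rw [abs_zero]; positivity
      · exact NearField.abs_sq_mul_sub_le (norm_nonneg _) (hψb ..) (NearField.abs_admissibleCosineMean_le_one _ _ fun n => hψb ..)
      · rw [abs_zero]; positivity
      · simp
  · intro N
    refine NearField.integrable_of_abs_le (hW N) ?_ ?_ fun z => ?_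
    · refine (NearField.measurable_sum_range (hK N) fun m => Finset.measurable_sum _ fun i _ => Finset.measurable_sum _ fun j _ => ?_).const_mul _
      refine Measurable.ite (NearField.measurableSet_hit _ (hpre N m) i j) ?_ measurable_const
      refine Measurable.ite (NearField.measurableSet_near _ (hpre N m) i j) ?_ measurable_const
      have hg := (NearField.measurable_vel' (hpre N m) i).fun_sub (NearField.measurable_vel' (hpre N m) j)
      have hxm := NearField.measurable_xmid' (hpre N m) i j
      refine Measurable.ite (measurableSet_lt measurable_const hg.norm) measurable_const ((hg.norm.pow_const 2).fun_mul ?_)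
      exact (NearField.measurable_admissibleCosineMean (hsDiameter σ N) (hpre N m) i j hxm hg
          (NearField.measurable_psiAt (hψm N) ((htc N m).comp measurable_fst) (hxm.comp measurable_fst)
            ((NearField.measurable_vel' (hpre N m) i).comp measurable_fst) ((NearField.measurable_vel' (hpre N m) j).comp measurable_fst) measurable_snd)).fun_sub
        (NearField.measurable_cosineMean (hψm N) (htc N m) hxm (NearField.measurable_vel' (hpre N m) i) (NearField.measurable_vel' (hpre N m) j) hg)
    · refine (NearField.measurable_sum_range (hK N) fun m => Finset.measurable_sum _ fun i _ => Finset.measurable_sum _ fun j _ => ?_).const_mul _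
      exact Measurable.ite (NearField.measurableSet_hit _ (hpre N m) i j) (hWm N m i j) measurable_const
    · refine NearField.abs_mul_sum3_le_two_mul _ _ (by positivity) _ _ fun m i j => ?_
      split_ifs
      · rw [abs_zero]; positivity
      · exact NearField.abs_sq_mul_sub_le (norm_nonneg _) (NearField.abs_admissibleCosineMean_le_one _ _ fun n => hψb ..) (hκ ..)
      · rw [abs_zero]; positivity
      · simp
  · intro N z
    rw [← mul_add, ← Finset.sum_add_distrib]
    refine congrArg _ (Finset.sum_congr rfl fun m _ => ?_)
    rw [← Finset.sum_add_distrib]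
    refine Finset.sum_congr rfl fun i _ => ?_
    rw [← Finset.sum_add_distrib]
    refine Finset.sum_congr rfl fun j _ => ?_
    split_ifs <;> ring

end Summit.AtomisticToContinuum.HydrodynamicLimit.Theorems.ContactAngleEquidistributionSketch

end
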